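import Literature.MathematicalPhysics.QuantumLattice.OverlapKernelTools
import Literature.MathematicalPhysics.QuantumLattice.WilsonDiracLowerBound
import Literature.Analysis.SpecialFunctions.LegendreGeneratingBound
import HarnessLib

/-!
# Discharge of `HJLLocality`: locality of Neuberger's overlap kernel (Hernández–Jansen–Lüscher 1999)

Topic `Literature/MathematicalPhysics/QuantumLattice`; namespace `Literature.MathematicalPhysics.QuantumLattice`.
Proves the named fact `HJLLocality ρ` of `OverlapLocality.lean` for every group `G`, every colour representation
`ρ : G →* Matrix (Fin N) (Fin N) ℂ`, on every periodic lattice `(ℤ/L)⁴` (`HJLLocality_holds`), following the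
printed proof of [HernandezJansenLuscher1999] (a sibling file because the proof needs `WilsonDiracLowerBound` and
`WilsonDiracRangeOne`, which import `OverlapLocality`):

* conjunct (1), the gap `A†A ≥ 1 − 30ε` under admissibility [(2.16), App. C] — `hjl_gap`: the tree's Neuberger
  bound `wilsonDirac_normSq_mulVec_ge_of_plaquette` [Neuberger2000Bounds] at `m = −1`, `δ = ε`, after noting
  that `‖1 − ρ(U_p)‖` is orientation independent (`norm_one_sub_rep_plaquetteHolonomy_swap`);
* conjunct (2), the Legendre-expansion locality [(2.5)–(2.12), torus transcription] — `hjl_legendre_locality`: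
  with `Q = D_Wᴴ D_W`, `spec Q ⊆ [u, v]` (quadratic-form hypotheses), `c = (v+u)/(v−u) = cosh θ`, `t = e^{−θ}`,
  `κ = (4t/(v−u))^{1/2}` and `z = (v+u−2Q)/(v−u)`: the Legendre generating function
  (`hasSum_legendre_generating`, the tree's Gegenbauer theory at `λ = 1/2`) gives at every eigenvalue
  `s^{-1/2} = κ Σ_k t^k P_k(ζ(s))` (`1 + t² = 2tc`, `1 − 2ζt + t² = 4ts/(v−u)`), hence
  `Q^{-1/2} = κ Σ_k t^k P_k(z)` block by block; `P_k(z)(x,y) = 0` for `2k < ‖x−y‖₁` because `P_k ∘ ζ` is a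
  polynomial of degree `≤ k` and `Q` has taxi range `2` [(2.11)]; `‖P_k(z)(x,y)‖ ≤ ‖P_k(z)‖ ≤ sup_{[−1,1]}|P_k| ≤ 1`;
  so `‖G(x,y)‖ ≤ κ Σ_{2k ≥ d} t^k = κ t^{⌈d/2⌉}/(1−t) ≤ κ/(1−t) · e^{−θd/2}` [(2.12)].

No definitions, no new named facts; net effect: the fact `HJLLocality` is discharged.

## References
* P. Hernández, K. Jansen, M. Lüscher, *Locality properties of Neuberger's lattice Dirac operator*,
  Nucl. Phys. B 552 (1999) 363–378, arXiv:hep-lat/9808010, §2, App. C. [HernandezJansenLuscher1999]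
* H. Neuberger, Phys. Rev. D 61 (2000) 085015, arXiv:hep-lat/9911004. [Neuberger2000Bounds]
* G. E. Andrews, R. Askey, R. Roy, *Special Functions*, CUP 1999, §6.4. [AndrewsAskeyRoy1999]
-/

noncomputable section

open Matrix Finset
open Literature.Probability.LatticeModels (TorusSite)
open Literature.MathematicalPhysics.QuantumFieldTheory

namespace Literature.MathematicalPhysics.QuantumLattice

/-! ### The locality bound (HJL (2.12)) -/

section Locality

open scoped Matrix.Norms.L2Operator
open Literature.Analysis.SpecialFunctions

variable {L N : ℕ} {G : Type*} [Group G] (ρ : G →* Matrix (Fin N) (Fin N) ℂ)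

/-- **The Legendre-expansion locality bound** [(2.12), torus transcription]: if
`u ≤ D_Wᴴ D_W ≤ v` as quadratic forms with `0 < u < v`, then the kernel of `(D_Wᴴ D_W)^{-1/2}` obeys
`‖G(x,y)‖ ≤ κ/(1−t) · exp(−θ‖x−y‖₁/2)` with HJL's constants. Proof as printed: `(A†A)^{-1/2} = κ Σ_k t^k P_k(z)`
(Legendre generating function at the spectrum), `P_k(z)(x,y) = 0` for `2k < ‖x−y‖₁` (`z` has taxi range `2`),
`‖P_k(z)‖ ≤ 1`, and the geometric tail. [cite: HernandezJansenLuscher1999, (2.5)–(2.12)] -/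
theorem hjl_legendre_locality [NeZero L] (hρ : ∀ g, ρ g ∈ Matrix.unitaryGroup (Fin N) ℂ)
    (U : GaugeConfig 4 L G) (m u v : ℝ) (hu : 0 < u) (huv : u < v)
    (hlow : ∀ ψ : TorusSite 4 L × Fin N × Fin 4 → ℂ,
      u * ∑ i, ‖ψ i‖ ^ 2 ≤ ∑ i, ‖(wilsonDirac ρ U m 1 *ᵥ ψ) i‖ ^ 2)
    (hup : ∀ ψ : TorusSite 4 L × Fin N × Fin 4 → ℂ,
      ∑ i, ‖(wilsonDirac ρ U m 1 *ᵥ ψ) i‖ ^ 2 ≤ v * ∑ i, ‖ψ i‖ ^ 2)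
    (x y : TorusSite 4 L) :
    ‖siteBlock (cfc (fun s : ℝ => (Real.sqrt s)⁻¹)
        ((wilsonDirac ρ U m 1)ᴴ * wilsonDirac ρ U m 1)) x y‖ ≤
      hjlKappa u v / (1 - hjlT u v) * Real.exp (-(hjlTheta u v * torusTaxiDist x y / 2)) := by
  set D := wilsonDirac ρ U m 1 with hD
  set Q := Dᴴ * D with hQdef
  have hQ : Q.IsHermitian := Matrix.isHermitian_conjTranspose_mul_self D
  -- the constants
  have hvu : 0 < v - u := by linarith
  set c : ℝ := (v + u) / (v - u) with hc
  have hc1 : 1 < c := by rw [hc, lt_div_iff₀ hvu]; linarith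
  set t : ℝ := hjlT u v with ht
  set κ : ℝ := hjlKappa u v with hκ
  have ht_def : t = Real.exp (-Real.arcosh c) := rfl
  have ht0 : 0 < t := Real.exp_pos _
  have ht1 : t < 1 := by
    rw [ht_def, Real.exp_lt_one_iff]
    exact neg_lt_zero.mpr (Real.arcosh_pos hc1)
  have htc : 1 + t ^ 2 = 2 * t * c := by
    have h1 : Real.cosh (Real.arcosh c) = c := Real.cosh_arcosh hc1.le
    rw [Real.cosh_eq, show Real.exp (Real.arcosh c) = t⁻¹ by
      rw [ht_def, Real.exp_neg, inv_inv], ← ht_def] at h1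
    field_simp at h1
    nlinarith [h1]
  have hκ0 : 0 ≤ κ := Real.sqrt_nonneg _
  have hκ_def : κ = Real.sqrt (4 * t / (v - u)) := rfl
  -- spectral data
  have hev : ∀ i, u ≤ hQ.eigenvalues i ∧ hQ.eigenvalues i ≤ v :=
    eigenvalues_mem_Icc_of_quadratic_bounds D hlow hup hQ
  -- the affine map onto [-1, 1]
  set ζ : ℝ → ℝ := fun s => (v + u - 2 * s) / (v - u) with hζdef
  have hζ : ∀ s, u ≤ s → s ≤ v → |ζ s| ≤ 1 := by
    intro s hs1 hs2
    rw [hζdef, abs_le]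
    constructor
    · rw [le_div_iff₀ hvu]; linarith
    · rw [div_le_iff₀ hvu]; linarith
  -- the scalar identity on [u, v]
  have hscalar : ∀ s, u ≤ s → s ≤ v →
      HasSum (fun k : ℕ => κ * t ^ k * gegenbauerSum (1 / 2) k (ζ s)) ((Real.sqrt s)⁻¹) := by
    intro s hs1 hs2
    have hs0 : 0 < s := hu.trans_le hs1
    have hgen := hasSum_legendre_generating (hζ s hs1 hs2) (r := t)
      (by rw [abs_of_pos ht0]; exact ht1)
    have hval : 1 - 2 * ζ s * t + t ^ 2 = 4 * t * s / (v - u) := by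
      have : 1 - 2 * ζ s * t + t ^ 2 = (1 + t ^ 2) - 2 * t * ζ s := by ring
      rw [this, htc, hζdef, hc]
      field_simp
      ring
    have hval2 : κ * (1 - 2 * ζ s * t + t ^ 2) ^ (-(1 / 2 : ℝ)) = (Real.sqrt s)⁻¹ := by
      rw [hval, hκ_def, Real.rpow_neg (div_nonneg (by positivity) hvu.le), ← Real.sqrt_eq_rpow, ← div_eq_mul_inv,
        ← Real.sqrt_div' _ (div_nonneg (by positivity) hvu.le), show 4 * t / (v - u) / (4 * t * s / (v - u)) = s⁻¹ by
          field_simp, Real.sqrt_inv]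
    have h3 := hgen.mul_left κ
    rw [hval2] at h3
    have hfun : (fun k : ℕ => κ * t ^ k * gegenbauerSum (1 / 2) k (ζ s)) =
        fun n : ℕ => κ * (gegenbauerSum (1 / 2) n (ζ s) * t ^ n) := by
      funext k; ring
    rw [hfun]
    exact h3
  -- the operator identity, block by block
  have hmat : HasSum (fun k : ℕ => ((κ * t ^ k : ℝ) : ℂ) •
      cfc (fun s : ℝ => gegenbauerSum (1 / 2) k (ζ s)) Q) (cfc (fun s : ℝ => (Real.sqrt s)⁻¹) Q) :=
    hasSum_smul_cfc_of_hasSum_eigenvalues hQ (fun k s => gegenbauerSum (1 / 2) k (ζ s)) _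
      (fun k => κ * t ^ k) fun i => hscalar _ (hev i).1 (hev i).2
  have hblk : HasSum (fun k : ℕ => ((κ * t ^ k : ℝ) : ℂ) •
      siteBlock (cfc (fun s : ℝ => gegenbauerSum (1 / 2) k (ζ s)) Q) x y)
      (siteBlock (cfc (fun s : ℝ => (Real.sqrt s)⁻¹) Q) x y) :=
    hmat.map (AddMonoidHom.mk' (fun M : Matrix (TorusSite 4 L × Fin N × Fin 4)
      (TorusSite 4 L × Fin N × Fin 4) ℂ => siteBlock M x y) (fun _ _ => rfl))
      (continuous_id.matrix_submatrix _ _)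
  -- vanishing of the short-range terms
  have hvanish : ∀ k : ℕ, 2 * k < torusTaxiDist x y →
      siteBlock (cfc (fun s : ℝ => gegenbauerSum (1 / 2) k (ζ s)) Q) x y = 0 := by
    intro k hk
    obtain ⟨q, hqdeg, hqeval⟩ :=
      exists_polynomial_gegenbauerSum_affine (1 / 2) k ((v + u) / (v - u)) (-2 / (v - u))
    have hfun : (fun s : ℝ => gegenbauerSum (1 / 2) k (ζ s)) = fun s => q.eval s := by
      funext s
      rw [hqeval, hζdef]
      congr 1
      field_simp
      ring
    have hcfc : cfc (fun s : ℝ => gegenbauerSum (1 / 2) k (ζ s)) Q = Polynomial.aeval Q q := by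
      rw [hfun]
      exact cfc_polynomial q Q hQ.isSelfAdjoint
    ext i j
    rw [siteBlock_apply, hcfc]
    exact aeval_apply_eq_zero_of_taxiRange
      (conjTranspose_mul_wilsonDirac_apply_eq_zero_of_two_lt ρ hρ U m) q _ _
      (by calc q.natDegree * 2 ≤ k * 2 := Nat.mul_le_mul_right 2 hqdeg
            _ < torusTaxiDist x y := by omega)
  -- the uniform bound on the Legendre terms
  have hnorm1 : ∀ k : ℕ, ‖siteBlock (cfc (fun s : ℝ => gegenbauerSum (1 / 2) k (ζ s)) Q) x y‖ ≤ 1 := by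
    intro k
    refine (norm_siteBlock_le _ x y).trans ?_
    rw [hQ.cfc_eq, Matrix.IsHermitian.cfc, Unitary.conjStarAlgAut_apply]
    refine l2_opNorm_unitary_conj_diagonal_le _ (hQ.eigenvectorUnitary).2 _ zero_le_one fun i => ?_
    simp only [Function.comp_apply, RCLike.norm_ofReal]
    exact abs_gegenbauerSum_half_le_one k (hζ _ (hev i).1 (hev i).2)
  -- the geometric tail
  set d : ℕ := torusTaxiDist x y with hd
  set k₀ : ℕ := (d + 1) / 2 with hk₀
  have hg : HasSum (fun k : ℕ => if k < k₀ then (0 : ℝ) else κ * t ^ k) (κ * t ^ k₀ / (1 - t)) := by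
    have h1 : HasSum (fun k : ℕ => κ * t ^ k₀ * t ^ k) (κ * t ^ k₀ * (1 - t)⁻¹) :=
      (hasSum_geometric_of_lt_one ht0.le ht1).mul_left (κ * t ^ k₀)
    rw [div_eq_mul_inv]
    rw [← hasSum_nat_add_iff' k₀]
    have hzero : ∑ i ∈ Finset.range k₀, (if i < k₀ then (0 : ℝ) else κ * t ^ i) = 0 :=
      Finset.sum_eq_zero fun i hi => by rw [if_pos (Finset.mem_range.mp hi)]
    rw [hzero, sub_zero]
    have hfun : (fun k : ℕ => if k + k₀ < k₀ then (0 : ℝ) else κ * t ^ (k + k₀)) =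
        fun k : ℕ => κ * t ^ k₀ * t ^ k := by
      funext k
      rw [if_neg (by omega), pow_add]
      ring
    rw [hfun]
    exact h1
  have hbound : ∀ k : ℕ, ‖((κ * t ^ k : ℝ) : ℂ) •
      siteBlock (cfc (fun s : ℝ => gegenbauerSum (1 / 2) k (ζ s)) Q) x y‖ ≤
      (if k < k₀ then (0 : ℝ) else κ * t ^ k) := by
    intro k
    split_ifs with hk
    · rw [hvanish k (by omega), smul_zero, norm_zero]
    · rw [norm_smul, Complex.norm_real, Real.norm_eq_abs, abs_of_nonneg (by positivity)]
      calc κ * t ^ k * ‖siteBlock (cfc (fun s : ℝ => gegenbauerSum (1 / 2) k (ζ s)) Q) x y‖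
          ≤ κ * t ^ k * 1 := by gcongr; exact hnorm1 k
        _ = κ * t ^ k := mul_one _
  have hfinal := HasSum.norm_le_of_bounded hblk hg hbound
  refine hfinal.trans ?_
  rw [exp_neg_hjlTheta_mul]
  have hpow : t ^ k₀ ≤ t ^ ((d : ℝ) / 2) := by
    rw [← Real.rpow_natCast]
    refine Real.rpow_le_rpow_of_exponent_ge ht0 ht1.le ?_
    rw [div_le_iff₀ (by norm_num : (0 : ℝ) < 2)]
    have : d ≤ k₀ * 2 := by omega
    exact_mod_cast this
  have h1t : 0 < 1 - t := by linarith
  calc κ * t ^ k₀ / (1 - t) = κ / (1 - t) * t ^ k₀ := by ring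
    _ ≤ κ / (1 - t) * t ^ ((d : ℝ) / 2) := mul_le_mul_of_nonneg_left hpow (by positivity)

end Locality


/-! ### The gap (HJL (2.16)) and the discharge of `HJLLocality` -/

section Discharge

open scoped Matrix.Norms.L2Operator

variable {L N : ℕ} {G : Type*} [Group G] (ρ : G →* Matrix (Fin N) (Fin N) ℂ)

omit ρ in
/-- Reversing the orientation of a plaquette inverts its holonomy. [folklore] -/
private theorem plaquetteHolonomy_rev {d : ℕ} (U : GaugeConfig d L G) (x : Site d L) (i j : Fin d) :
    plaquetteHolonomy U x j i = (plaquetteHolonomy U x i j)⁻¹ := by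
  simp only [plaquetteHolonomy, _root_.mul_inv_rev, inv_inv, mul_assoc]

/-- The plaquette deviation `‖1 − ρ(U_p)‖` does not depend on the orientation of `p`
(`ρ(U_p⁻¹) = ρ(U_p)ᴴ` and `‖Xᴴ‖ = ‖X‖`). [cite: HernandezJansenLuscher1999, (2.15)] -/
theorem norm_one_sub_rep_plaquetteHolonomy_swap (hρ : ∀ g, ρ g ∈ Matrix.unitaryGroup (Fin N) ℂ)
    (U : GaugeConfig 4 L G) (y : TorusSite 4 L) (μ ν : Fin 4) :
    ‖(1 : Matrix (Fin N) (Fin N) ℂ) - ρ (plaquetteHolonomy U y ν μ)‖ =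
      ‖(1 : Matrix (Fin N) (Fin N) ℂ) - ρ (plaquetteHolonomy U y μ ν)‖ := by
  rw [plaquetteHolonomy_rev, ← star_rep_eq_rep_inv ρ hρ, star_eq_conjTranspose,
    ← Matrix.l2_opNorm_conjTranspose ((1 : Matrix (Fin N) (Fin N) ℂ) - ρ (plaquetteHolonomy U y μ ν)),
    conjTranspose_sub, conjTranspose_one]

/-- **The gap `A†A ≥ 1 − 30ε` under admissibility** [(2.16), App. C]: the tree's Neuberger bound
`wilsonDirac_normSq_mulVec_ge_of_plaquette` at `m = −1`, `δ = ε` (admissibility is stated for positively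
oriented plaquettes; the deviation norm is orientation independent). [cite: HernandezJansenLuscher1999, (2.16)] -/
theorem hjl_gap [NeZero L] (hρ : ∀ g, ρ g ∈ Matrix.unitaryGroup (Fin N) ℂ) (U : GaugeConfig 4 L G)
    (ε : ℝ) (hU : IsNormAdmissible ρ U ε) (ψ : TorusSite 4 L × Fin N × Fin 4 → ℂ) :
    (1 - 30 * ε) * ∑ i, ‖ψ i‖ ^ 2 ≤ ∑ i, ‖(wilsonDirac ρ U (-1) 1 *ᵥ ψ) i‖ ^ 2 := by
  have hε := hU.nonneg
  have h := wilsonDirac_normSq_mulVec_ge_of_plaquette ρ hρ U (-1) le_rfl ε hε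
    (fun y μ ν hne => by
      rcases lt_or_gt_of_ne hne with h | h
      · exact hU (y, ⟨(μ, ν), h⟩)
      · rw [← norm_one_sub_rep_plaquetteHolonomy_swap ρ hρ]
        exact hU (y, ⟨(ν, μ), h⟩)) ψ
  norm_num at h
  exact h

/-- **Discharge of the named fact `HJLLocality`** (Hernández–Jansen–Lüscher 1999, (2.16) and (2.12) on
every periodic lattice): conjunct (1) is `hjl_gap`, conjunct (2) is `hjl_legendre_locality`.
[cite: HernandezJansenLuscher1999, (2.16) and (2.12)] -/
theorem HJLLocality_holds : HJLLocality ρ :=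
  ⟨fun hρ _ _ U ε hU ψ => hjl_gap ρ hρ U ε hU ψ,
    fun hρ _ _ U m u v _ _ hu huv hlow hup x y =>
      hjl_legendre_locality ρ hρ U m u v hu huv hlow hup x y⟩

end Discharge

end Literature.MathematicalPhysics.QuantumLattice

end
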